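import Summits.Ventures.HodgeRepro2.T5FinitePlaceIsotropy
import Summits.Ventures.HodgeRepro2.T5FinitePlaceSplitClassification

/-!
# Row N2.2.2's non-split case on the route's own local algebra `K⁺_v ⊗ K`, with no binder
(cell pub-hodge-repro2, seat p3)

Tier-5 N2 support, rows N2.2.2 / N2.8.1 of route/T5-N2-route-3.md. File 146 stated the SPLIT case of row N2.2.2
(«one class per dimension») on the route's local algebra `K⁺_v ⊗_{K⁺} K` with the conjugation `1 ⊗ c`
(`tensorStarRing`); file 150 proved the NON-SPLIT case (Shimura's Lemma 1.6, the Hilbert-symbol criterion, HKS96's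
«precisely two classes») on the completion `K_w` with its local conjugation, unconditionally. Here the non-split
case is carried to the same algebra `K⁺_v ⊗ K` along file 115's `K⁺_v ⊗ K ≃ K_w` (`tensorLiftEquivOfNotIsSquare`):

* `tensorLiftEquiv_star` / `tensorLiftEquiv_algebraMap` / **`exists_ringEquiv_star_comm`**: the isomorphism
  carries `1 ⊗ c` to the local conjugation of `K_w` (file 119's star IS `extendAut c`, i.e. `1 ⊗ c` transported —
  by definition) and `a ⊗ 1` to `a` (seat p4's structure map, through file 141's concordance);
* `det_map_ringEquiv`, `map_map_symm_ringEquiv`, `map_symm_map_ringEquiv`: transport bookkeeping for matrices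
  along any ring isomorphism;
* **`isCongruent_iff_exists_det_eq_tensor`**: Shimura's Lemma 1.6 on `K⁺_v ⊗ K` at a non-split place;
* **`isCongruent_iff_hilbertSolvable_tensor`**: row N2.8.1 (i) on `K⁺_v ⊗ K` — Gram matrices with
  `det H' = (a ⊗ 1) · det H` are congruent iff `(a, θ)_v = 1`;
* **`exists_two_classes_tensor`**: HKS96's «precisely two isomorphism classes in each dimension» on `K⁺_v ⊗ K`.

With file 146 (`exists_isCongruent_one` / `isCongruent_of_isHermitian` at a split place) row N2.2.2 is now
stated and proved on ONE algebra, the route's `K⁺_v ⊗ K`, at every finite place of `K⁺`, with no printed input.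
The transport is file 146's generic lemmas for star-compatible ring homomorphisms. The scoped `Algebra K⁺_v K_w`
of file 115 (inside the type of `tensorLiftEquivOfNotIsSquare`) and seat p4's global one are NOT definitionally
equal (file 141 proves them equal): the namespace `T5FinitePlaceLiesOver` is not opened, the instance is passed
explicitly where the algebra equivalence is turned into a ring equivalence, and everything else is done with the
ring equivalence. Mathlib + this seat's files 115–150 and seat p4's chain through them only; no display; no
device. §8(d): uses an L-value-free non-vanishing device: NO.
-/

namespace Summit.Ventures.HodgeRepro2.T5FinitePlaceTensorClassification

open IsDedekindDomain IsDedekindDomain.HeightOneSpectrum NumberField NumberField.IsCMField Module Matrix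
open scoped TensorProduct
open Summit.Ventures.HodgeRepro2.T5FinitePlaceTensorEquiv Summit.Ventures.HodgeRepro2.T5FinitePlaceStar
  Summit.Ventures.HodgeRepro2.T5FinitePlaceSplitConj Summit.Ventures.HodgeRepro2.T5FinitePlaceSplitClassification
  Summit.Ventures.HodgeRepro2.T5HermitianDetClass Summit.Ventures.HodgeRepro2.T5HermitianClassify
  Summit.Ventures.HodgeRepro2.T5HilbertSymbolNorm Summit.Ventures.HodgeRepro2.T5FinitePlaceNormIndex
  Summit.Ventures.HodgeRepro2.T5FinitePlaceIsotropy

section Transport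

variable {R S : Type*} [CommRing R] [CommRing S] {n : Type*} [Fintype n] [DecidableEq n]

/-- The determinant commutes with a ring isomorphism applied entrywise. -/
theorem det_map_ringEquiv (e : R ≃+* S) (H : Matrix n n R) : (H.map e.toRingHom).det = e H.det := by
  rw [← RingHom.mapMatrix_apply, ← RingHom.map_det]
  rfl

omit [Fintype n] [DecidableEq n] in
/-- Applying a ring isomorphism and its inverse entrywise is the identity. -/
theorem map_map_symm_ringEquiv (e : R ≃+* S) (H : Matrix n n R) :
    (H.map e.toRingHom).map e.symm.toRingHom = H := by
  rw [Matrix.map_map]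
  ext i j
  simp only [Matrix.map_apply, Function.comp_apply]
  exact e.symm_apply_apply (H i j)

omit [Fintype n] [DecidableEq n] in
/-- Applying the inverse of a ring isomorphism and then the isomorphism entrywise is the identity. -/
theorem map_symm_map_ringEquiv (e : R ≃+* S) (H : Matrix n n S) :
    (H.map e.symm.toRingHom).map e.toRingHom = H := by
  rw [Matrix.map_map]
  ext i j
  simp only [Matrix.map_apply, Function.comp_apply]
  exact e.apply_symm_apply (H i j)

end Transport

section NonSplit

variable (K : Type*) [Field K] [NumberField K] [IsCMField K]
variable (v : HeightOneSpectrum (𝓞 (maximalRealSubfield K))) (w : HeightOneSpectrum (𝓞 K))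
  [w.asIdeal.LiesOver v.asIdeal]
variable {s : K} {θ : maximalRealSubfield K}
  (hs : s ^ 2 = algebraMap (maximalRealSubfield K) K θ)
  (hspan : Submodule.span (maximalRealSubfield K) {(1 : K), s} = ⊤)
  (hsq : ¬ IsSquare (algebraMap (maximalRealSubfield K) (v.adicCompletion (maximalRealSubfield K)) θ))
  (hc : complexConj K s = -s)

/-- **`K⁺_v ⊗ K ≃ K_w` carries `1 ⊗ c` to the local conjugation:** file 119's star on `K_w` is `extendAut c`,
i.e. `1 ⊗ c` transported along `tensorLiftEquiv` — by definition. (The `Algebra K⁺_v K_w` of file 115 is passed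
explicitly: it is the one inside the type of `tensorLiftEquivOfNotIsSquare`.) -/
theorem tensorLiftEquiv_star (z : (v.adicCompletion (maximalRealSubfield K)) ⊗[maximalRealSubfield K] K) :
    letI := tensorStarRing K v
    letI := localStarRing v w hs hspan hsq (complexConj K) hc
    (@AlgEquiv.toRingEquiv _ _ _ _ _ _ _
      (Summit.Ventures.HodgeRepro2.T5FinitePlaceLiesOver.instAlgebra (maximalRealSubfield K) K v w)
      (tensorLiftEquivOfNotIsSquare v w hs hspan hsq)) (star z) =
    star ((@AlgEquiv.toRingEquiv _ _ _ _ _ _ _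
      (Summit.Ventures.HodgeRepro2.T5FinitePlaceLiesOver.instAlgebra (maximalRealSubfield K) K v w)
      (tensorLiftEquivOfNotIsSquare v w hs hspan hsq)) z) := by
  letI := tensorStarRing K v
  letI := localStarRing v w hs hspan hsq (complexConj K) hc
  simp only [tensorStar_def, star_def, extendAutOfNotIsSquare, extendAut, tensorLiftEquivOfNotIsSquare,
    AlgEquiv.coe_ringEquiv, AlgEquiv.trans_apply, AlgEquiv.symm_apply_apply]
  rfl

/-- **`K⁺_v ⊗ K ≃ K_w` carries `a ⊗ 1` to `a`** (seat p4's structure map `K⁺_v → K_w`, through file 141's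
concordance with file 115's). -/
theorem tensorLiftEquiv_algebraMap (a : v.adicCompletion (maximalRealSubfield K)) :
    (@AlgEquiv.toRingEquiv _ _ _ _ _ _ _
      (Summit.Ventures.HodgeRepro2.T5FinitePlaceLiesOver.instAlgebra (maximalRealSubfield K) K v w)
      (tensorLiftEquivOfNotIsSquare v w hs hspan hsq))
      (algebraMap (v.adicCompletion (maximalRealSubfield K))
        ((v.adicCompletion (maximalRealSubfield K)) ⊗[maximalRealSubfield K] K) a) =
    algebraMap (v.adicCompletion (maximalRealSubfield K)) (w.adicCompletion K) a := by
  rw [algebraMap_apply' v w a]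
  exact @AlgEquiv.commutes _ _ _ _ _ _ _
    (Summit.Ventures.HodgeRepro2.T5FinitePlaceLiesOver.instAlgebra (maximalRealSubfield K) K v w)
    (tensorLiftEquivOfNotIsSquare v w hs hspan hsq) a

/-- **The route's local algebra at a non-split place IS the completion, with its conjugation:** a ring isomorphism
`K⁺_v ⊗ K ≃+* K_w` carrying `1 ⊗ c` to the local conjugation and `a ⊗ 1` to `a`. -/
theorem exists_ringEquiv_star_comm :
    letI := tensorStarRing K v
    letI := localStarRing v w hs hspan hsq (complexConj K) hc
    ∃ e : ((v.adicCompletion (maximalRealSubfield K)) ⊗[maximalRealSubfield K] K) ≃+* w.adicCompletion K,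
      (∀ z, e (star z) = star (e z)) ∧
        ∀ a : v.adicCompletion (maximalRealSubfield K),
          e (algebraMap (v.adicCompletion (maximalRealSubfield K))
            ((v.adicCompletion (maximalRealSubfield K)) ⊗[maximalRealSubfield K] K) a) =
          algebraMap (v.adicCompletion (maximalRealSubfield K)) (w.adicCompletion K) a :=
  ⟨_, tensorLiftEquiv_star K v w hs hspan hsq hc, tensorLiftEquiv_algebraMap K v w hs hspan hsq⟩

include w hs hspan hsq hc in
/-- **Shimura's Lemma 1.6 on the route's local algebra `K⁺_v ⊗ K` at a non-split place** (Doc. Math. 13 p. 745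
ll. 22–23), with no binder: two invertible hermitian matrices (conjugation `1 ⊗ c`) of the same size are congruent
iff their determinants differ by a norm `star u · u`. -/
theorem isCongruent_iff_exists_det_eq_tensor {n : Type*} [Fintype n] [DecidableEq n]
    {H H' : Matrix n n ((v.adicCompletion (maximalRealSubfield K)) ⊗[maximalRealSubfield K] K)}
    (hH : letI := tensorStarRing K v; H.IsHermitian) (hH' : letI := tensorStarRing K v; H'.IsHermitian)
    (hdet : IsUnit H.det) :
    letI := tensorStarRing K v
    IsCongruent H H' ↔ ∃ u : (v.adicCompletion (maximalRealSubfield K)) ⊗[maximalRealSubfield K] K,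
      u ≠ 0 ∧ H'.det = star u * u * H.det := by
  letI := tensorStarRing K v
  letI := localStarRing v w hs hspan hsq (complexConj K) hc
  obtain ⟨e, hstar, -⟩ := exists_ringEquiv_star_comm K v w hs hspan hsq hc
  have hstar' : ∀ z, e.toRingHom (star z) = star (e.toRingHom z) := hstar
  have hstar'' : ∀ z, e.symm.toRingHom (star z) = star (e.symm.toRingHom z) := symm_star_comm e hstar
  have hH₁ : (H.map e.toRingHom).IsHermitian := isHermitian_map_of_star_comm e.toRingHom hstar' hH
  have hH₁' : (H'.map e.toRingHom).IsHermitian := isHermitian_map_of_star_comm e.toRingHom hstar' hH'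
  have hd₁ : IsUnit (H.map e.toRingHom).det := isUnit_det_map e.toRingHom hdet
  have key := isCongruent_iff_exists_det_eq_local_of_nonsplit v w hs hspan hsq (complexConj K) hc hH₁ hH₁' hd₁
  have hdetH : (H.map e.toRingHom).det = e H.det := det_map_ringEquiv e H
  have hdetH' : (H'.map e.toRingHom).det = e H'.det := det_map_ringEquiv e H'
  constructor
  · intro h
    obtain ⟨u', hu', hdet'⟩ := key.1 (isCongruent_map_of_star_comm e.toRingHom hstar' h)
    refine ⟨e.symm u', fun h0 => hu' (e.symm.map_eq_zero_iff.1 h0), ?_⟩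
    apply e.injective
    rw [map_mul, map_mul, hstar, e.apply_symm_apply, ← hdetH', ← hdetH]
    exact hdet'
  · rintro ⟨u, hu, hdet'⟩
    have h₁ : IsCongruent (H.map e.toRingHom) (H'.map e.toRingHom) := by
      refine key.2 ⟨e u, fun h0 => hu (e.map_eq_zero_iff.1 h0), ?_⟩
      rw [hdetH', hdetH, hdet', map_mul, map_mul, hstar]
    have h₂ := isCongruent_map_of_star_comm e.symm.toRingHom hstar'' h₁
    rwa [map_map_symm_ringEquiv, map_map_symm_ringEquiv] at h₂

include w hs hspan hsq hc in
/-- **Row N2.8.1 (i) on the route's local algebra `K⁺_v ⊗ K` at a non-split place**, with no binder: Gram matrices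
with `det H' = (a ⊗ 1) · det H`, `a ∈ K⁺_v^×`, are congruent iff `(a, θ)_v = 1` (O'Meara 63:1's equation
`a ξ² + θ η² = 1` solvable in `K⁺_v`). -/
theorem isCongruent_iff_hilbertSolvable_tensor {n : Type*} [Fintype n] [DecidableEq n]
    {H H' : Matrix n n ((v.adicCompletion (maximalRealSubfield K)) ⊗[maximalRealSubfield K] K)}
    (hH : letI := tensorStarRing K v; H.IsHermitian) (hH' : letI := tensorStarRing K v; H'.IsHermitian)
    (hdet : IsUnit H.det) {a : v.adicCompletion (maximalRealSubfield K)} (ha : a ≠ 0)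
    (hdet' : H'.det = algebraMap (v.adicCompletion (maximalRealSubfield K))
      ((v.adicCompletion (maximalRealSubfield K)) ⊗[maximalRealSubfield K] K) a * H.det) :
    letI := tensorStarRing K v
    IsCongruent H H' ↔
      HilbertSolvable a (algebraMap (maximalRealSubfield K) (v.adicCompletion (maximalRealSubfield K)) θ) := by
  letI := tensorStarRing K v
  letI := localStarRing v w hs hspan hsq (complexConj K) hc
  obtain ⟨e, hstar, halg⟩ := exists_ringEquiv_star_comm K v w hs hspan hsq hc
  have hstar' : ∀ z, e.toRingHom (star z) = star (e.toRingHom z) := hstar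
  have hstar'' : ∀ z, e.symm.toRingHom (star z) = star (e.symm.toRingHom z) := symm_star_comm e hstar
  have hH₁ : (H.map e.toRingHom).IsHermitian := isHermitian_map_of_star_comm e.toRingHom hstar' hH
  have hH₁' : (H'.map e.toRingHom).IsHermitian := isHermitian_map_of_star_comm e.toRingHom hstar' hH'
  have hd₁ : IsUnit (H.map e.toRingHom).det := isUnit_det_map e.toRingHom hdet
  have hdet'' : (H'.map e.toRingHom).det =
      algebraMap (v.adicCompletion (maximalRealSubfield K)) (w.adicCompletion K) a * (H.map e.toRingHom).det := by
    rw [det_map_ringEquiv, det_map_ringEquiv, hdet', map_mul, halg]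
  rw [← isCongruent_iff_hilbertSolvable_local_of_nonsplit v w hs hspan hsq (complexConj K) hc hH₁ hH₁' hd₁ ha
    hdet'']
  constructor
  · exact isCongruent_map_of_star_comm e.toRingHom hstar'
  · intro h
    have h₂ := isCongruent_map_of_star_comm e.symm.toRingHom hstar'' h
    rwa [map_map_symm_ringEquiv, map_map_symm_ringEquiv] at h₂

include w hs hspan hsq hc in
/-- **HKS96's «precisely two isomorphism classes in each dimension» on the route's local algebra `K⁺_v ⊗ K` at a
non-split place**, with no binder: for every `m`, two invertible hermitian `(m+1) × (m+1)` matrices, not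
congruent, such that every invertible hermitian matrix is congruent to one of them. -/
theorem exists_two_classes_tensor (m : ℕ) :
    letI := tensorStarRing K v
    ∃ H₁ H₂ : Matrix (Fin (m + 1)) (Fin (m + 1))
        ((v.adicCompletion (maximalRealSubfield K)) ⊗[maximalRealSubfield K] K),
      H₁.IsHermitian ∧ H₂.IsHermitian ∧ IsUnit H₁.det ∧ IsUnit H₂.det ∧ ¬ IsCongruent H₁ H₂ ∧
        ∀ H : Matrix (Fin (m + 1)) (Fin (m + 1))
          ((v.adicCompletion (maximalRealSubfield K)) ⊗[maximalRealSubfield K] K),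
          H.IsHermitian → IsUnit H.det → IsCongruent H H₁ ∨ IsCongruent H H₂ := by
  letI := tensorStarRing K v
  letI := localStarRing v w hs hspan hsq (complexConj K) hc
  obtain ⟨e, hstar, -⟩ := exists_ringEquiv_star_comm K v w hs hspan hsq hc
  have hstar' : ∀ z, e.toRingHom (star z) = star (e.toRingHom z) := hstar
  have hstar'' : ∀ z, e.symm.toRingHom (star z) = star (e.symm.toRingHom z) := symm_star_comm e hstar
  obtain ⟨H₁, H₂, h₁, h₂, d₁, d₂, hnc, hall⟩ :=
    exists_two_classes_local_of_nonsplit v w hs hspan hsq (complexConj K) hc m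
  refine ⟨H₁.map e.symm.toRingHom, H₂.map e.symm.toRingHom, isHermitian_map_of_star_comm _ hstar'' h₁,
    isHermitian_map_of_star_comm _ hstar'' h₂, isUnit_det_map _ d₁, isUnit_det_map _ d₂, ?_, ?_⟩
  · intro h
    have h' := isCongruent_map_of_star_comm e.toRingHom hstar' h
    rw [map_symm_map_ringEquiv, map_symm_map_ringEquiv] at h'
    exact hnc h'
  · intro H hH hd
    rcases hall (H.map e.toRingHom) (isHermitian_map_of_star_comm _ hstar' hH) (isUnit_det_map _ hd) with h | h
    · left
      have h' := isCongruent_map_of_star_comm e.symm.toRingHom hstar'' h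
      rwa [map_map_symm_ringEquiv] at h'
    · right
      have h' := isCongruent_map_of_star_comm e.symm.toRingHom hstar'' h
      rwa [map_map_symm_ringEquiv] at h'

end NonSplit

end Summit.Ventures.HodgeRepro2.T5FinitePlaceTensorClassification
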